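import Summits.HubbardSuperconductivity.HubbardSuperconductivity.Theorems.AnisotropyChordInsertionEntropyRoute
import Literature.Probability.LatticeModels.BoxDirichlet

/-!
# Route `AnisotropyChord` / H0 rotor rung: LEMMA LOG-DIRICHLET (theory seat cycle 8, memo ROTOR-THEORY-8 §111;
# Sketch8 Part J ported) — the ground-state-transform identity for a positive solution and the bound on its
# log-Dirichlet energy

Abstract form (Mathlib-only): weights `m`, a kernel `r` reversible w.r.t. `m`, a positive solution `Φ` of
`μ Φ = −LΦ + WΦ` with `(−LΦ)(ω) = Σ_{ω′} r(ω,ω′)(Φ(ω) − Φ(ω′))`.  Then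
`½ Σ m r (Φ′/Φ + Φ/Φ′ − 2) = Σ m (W − μ)` EXACTLY (`logDirichlet_identity`, Allegretto–Piepenbrink / ground-state
transform), and the log-Dirichlet energy `½ Σ m r (log Φ′ − log Φ)²` is bounded by the same quantity
(`logDirichlet_energy_le`, via `(log a)² ≤ a + 1/a − 2`).  Applied (memo §111) on the pair space `{(x,τ) : x ∉ τ}`
with `m = ψ_M(τ)²`, Doob rates, `Φ = ψ_N(τ ∪ x)/ψ_M(τ)` (the insertion amplitude of the entropy route),
`μ = E_N − E_M` and the contact potential `W`: the insertion amplitude has `O(1)` log-energy, so the condensation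
crux `InsertionEntropyBound` becomes a RESTRICTED log-Sobolev statement for the one function `Φ`
(theory seat memo §111 (P1)/(P2)).  Checked numerically to 6e−15 (4×4, N = 3).
-/

set_option linter.dupNamespace false

noncomputable section

open Finset

namespace Summit.HubbardSuperconductivity.HubbardSuperconductivity.Theorems.AnisotropyChord.InsertionEntropy

section LogDirichlet

variable {Ω : Type*} [Fintype Ω]

/-- **LEMMA LOG-DIRICHLET, identity form** (ground-state transform; theory seat memo ROTOR-THEORY-8 §111 (ii)):
for `r` reversible w.r.t. `m` and a positive solution of `μΦ = −LΦ + WΦ`,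
`½ Σ_ω Σ_ω′ m(ω) r(ω,ω′) (Φ(ω′)/Φ(ω) + Φ(ω)/Φ(ω′) − 2) = Σ_ω m(ω)(W(ω) − μ)`. [folklore] -/
theorem logDirichlet_identity (m : Ω → ℝ) (r : Ω → Ω → ℝ) (Φ W : Ω → ℝ) (μ : ℝ)
    (hrev : ∀ ω ω', m ω * r ω ω' = m ω' * r ω' ω) (hΦ : ∀ ω, 0 < Φ ω)
    (heq : ∀ ω, μ * Φ ω = (∑ ω', r ω ω' * (Φ ω - Φ ω')) + W ω * Φ ω) :
    (1 / 2 : ℝ) * ∑ ω, ∑ ω', m ω * r ω ω' * (Φ ω' / Φ ω + Φ ω / Φ ω' - 2)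
      = ∑ ω, m ω * (W ω - μ) := by
  -- the two ratio sums coincide by reversibility
  have hswap : ∑ ω, ∑ ω', m ω * r ω ω' * (Φ ω / Φ ω') = ∑ ω, ∑ ω', m ω * r ω ω' * (Φ ω' / Φ ω) := by
    rw [Finset.sum_comm]
    refine Finset.sum_congr rfl fun ω _ => Finset.sum_congr rfl fun ω' _ => ?_
    rw [hrev ω' ω]
  -- the single ratio sum evaluates through the equation
  have hone : ∑ ω, ∑ ω', m ω * r ω ω' * (Φ ω' / Φ ω - 1) = ∑ ω, m ω * (W ω - μ) := by
    refine Finset.sum_congr rfl fun ω _ => ?_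
    have hΦω := (hΦ ω).ne'
    have h1 : ∑ ω', m ω * r ω ω' * (Φ ω' / Φ ω - 1) = (m ω / Φ ω) * ∑ ω', r ω ω' * (Φ ω' - Φ ω) := by
      rw [Finset.mul_sum]
      refine Finset.sum_congr rfl fun ω' _ => ?_
      field_simp
    have h2 : ∑ ω', r ω ω' * (Φ ω' - Φ ω) = (W ω - μ) * Φ ω := by
      have := heq ω
      have h3 : ∑ ω', r ω ω' * (Φ ω' - Φ ω) = -∑ ω', r ω ω' * (Φ ω - Φ ω') := by
        rw [← Finset.sum_neg_distrib]; refine Finset.sum_congr rfl fun ω' _ => ?_; ring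
      rw [h3]; linarith
    rw [h1, h2]; field_simp
  have hsplit : ∑ ω, ∑ ω', m ω * r ω ω' * (Φ ω' / Φ ω + Φ ω / Φ ω' - 2)
      = ∑ ω, ∑ ω', m ω * r ω ω' * (Φ ω' / Φ ω - 1) + ∑ ω, ∑ ω', m ω * r ω ω' * (Φ ω / Φ ω' - 1) := by
    rw [← Finset.sum_add_distrib]
    refine Finset.sum_congr rfl fun ω _ => ?_
    rw [← Finset.sum_add_distrib]
    refine Finset.sum_congr rfl fun ω' _ => ?_
    ring
  have hswap' : ∑ ω, ∑ ω', m ω * r ω ω' * (Φ ω / Φ ω' - 1)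
      = ∑ ω, ∑ ω', m ω * r ω ω' * (Φ ω' / Φ ω - 1) := by
    have hA : ∑ ω, ∑ ω', m ω * r ω ω' * (Φ ω / Φ ω' - 1)
        = ∑ ω, ∑ ω', m ω * r ω ω' * (Φ ω / Φ ω') - ∑ ω, ∑ ω', m ω * r ω ω' := by
      rw [← Finset.sum_sub_distrib]; refine Finset.sum_congr rfl fun ω _ => ?_
      rw [← Finset.sum_sub_distrib]; refine Finset.sum_congr rfl fun ω' _ => ?_; ring
    have hB : ∑ ω, ∑ ω', m ω * r ω ω' * (Φ ω' / Φ ω - 1)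
        = ∑ ω, ∑ ω', m ω * r ω ω' * (Φ ω' / Φ ω) - ∑ ω, ∑ ω', m ω * r ω ω' := by
      rw [← Finset.sum_sub_distrib]; refine Finset.sum_congr rfl fun ω _ => ?_
      rw [← Finset.sum_sub_distrib]; refine Finset.sum_congr rfl fun ω' _ => ?_; ring
    rw [hA, hB, hswap]
  rw [hsplit, hswap', hone]; ring

/-- `(log a)² ≤ a + 1/a − 2` for `a > 0` (i.e. `x² ≤ 2(cosh x − 1)`; the tree's `sq_div_two_le_cosh_sub_one`). [folklore] -/
theorem log_sq_le_ratio (a : ℝ) (ha : 0 < a) : Real.log a ^ 2 ≤ a + 1 / a - 2 := by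
  have hx : ∀ x : ℝ, x ^ 2 ≤ Real.exp x + Real.exp (-x) - 2 := by
    intro x
    have h := Literature.Probability.LatticeModels.sq_div_two_le_cosh_sub_one x
    rw [Real.cosh_eq] at h
    linarith
  have := hx (Real.log a)
  rwa [Real.exp_log ha, Real.exp_neg, Real.exp_log ha, ← one_div] at this

/-- **LEMMA LOG-DIRICHLET, energy form** (theory seat memo ROTOR-THEORY-8 §111): the log-Dirichlet energy of a
positive solution is at most `Σ m (W − μ)`:
`½ Σ_ω Σ_ω′ m(ω) r(ω,ω′) (log Φ(ω′) − log Φ(ω))² ≤ Σ_ω m(ω)(W(ω) − μ)`. [folklore] -/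
theorem logDirichlet_energy_le (m : Ω → ℝ) (r : Ω → Ω → ℝ) (Φ W : Ω → ℝ) (μ : ℝ)
    (hm : ∀ ω, 0 ≤ m ω) (hr : ∀ ω ω', 0 ≤ r ω ω')
    (hrev : ∀ ω ω', m ω * r ω ω' = m ω' * r ω' ω) (hΦ : ∀ ω, 0 < Φ ω)
    (heq : ∀ ω, μ * Φ ω = (∑ ω', r ω ω' * (Φ ω - Φ ω')) + W ω * Φ ω) :
    (1 / 2 : ℝ) * ∑ ω, ∑ ω', m ω * r ω ω' * (Real.log (Φ ω') - Real.log (Φ ω)) ^ 2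
      ≤ ∑ ω, m ω * (W ω - μ) := by
  rw [← logDirichlet_identity m r Φ W μ hrev hΦ heq]
  refine mul_le_mul_of_nonneg_left ?_ (by norm_num)
  refine Finset.sum_le_sum fun ω _ => Finset.sum_le_sum fun ω' _ => ?_
  refine mul_le_mul_of_nonneg_left ?_ (mul_nonneg (hm ω) (hr ω ω'))
  have ha : 0 < Φ ω' / Φ ω := div_pos (hΦ ω') (hΦ ω)
  have h := log_sq_le_ratio _ ha
  rw [Real.log_div (hΦ ω').ne' (hΦ ω).ne'] at h
  have hinv : 1 / (Φ ω' / Φ ω) = Φ ω / Φ ω' := by rw [one_div, inv_div]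
  rw [hinv] at h
  exact h

end LogDirichlet

end Summit.HubbardSuperconductivity.HubbardSuperconductivity.Theorems.AnisotropyChord.InsertionEntropy
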